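import Literature.NumberTheory.LFunctions.ConreyIwaniec2002MeanValueDefs
import Literature.NumberTheory.LFunctions.ClassGroupCharacterEulerProduct
import Literature.NumberTheory.Sieve.RamanujanSum
import Literature.Analysis.FunctionSpaces.BesselJ
import Mathlib.Analysis.Fourier.FourierTransform
import Mathlib.NumberTheory.LegendreSymbol.JacobiSymbol
import HarnessLib

/-!
# Conrey–Iwaniec (2002), §4: the vocabulary of Kloosterman's circle method "in an axiomatic setting" (summation datum, kernel bound, `σ(h)`, `p(c)`)

B. Conrey, H. Iwaniec, *Spacing of zeros of Hecke `L`-functions and the class number problem*,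
Acta Arith. 103 (2002) 259–312 [held text `paper:arxiv-math_0111012`, chunks p0009–p0013].
DEFINITIONS ONLY, for the cell `landau-siegel/ls-inputs` line `theta-circle-method` (SKELETON S3)
towards the registered stub S3 `ConreyIwaniec2002.stub_shifted_convolution` of SKELETON P64
(Theorems 4.3/4.4 for the class-group theta series, consumed by `proposition64_of` towards the
typed named fact `conreyIwaniec2002_proposition64`); the six stubs of that line's skeleton are
stated over the present vocabulary and that of `ConreyIwaniec2002MeanValueDefs.lean`
(`IsBumpOn`, `IsCISigma`, `ShiftedConvolutionBound`). Nothing is asserted here.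

## What the source prints

**§4 (4.2)–(4.9)** (p0010:L27–56). `S(α) = Σ_n λ(n)e(αn)g(n)` (4.2); "We assume that for any
`c ≥ 1` and `(a,c) = 1` one has the expansion `S(a/c) = Σ_{m≥0} ψ_m(a)e(ā l_m/c)∫₀^∞ g(x)k_m(x)dx`
(4.3) where `aā ≡ 1 (mod c)`, `ψ_m(a)` are periodic in `a`, say of a fixed period `q`, `l_m` are
integers, and `k_m(x)` are smooth functions. We do allow `ψ_m(a)`, `l_m` and `k_m(x)` to depend on
`c`. However the frequencies `l_m` and the kernels `k_m(x)` cannot depend on `a`. If `m ≥ 0`"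
[sic, `m ≥ 1`] "we require `|ψ_m(a)| ≤ Aτ(m)c^{-1}` (4.4) … `|ĝ_m(α)| ≤ BcCm^{-5/4}` if
`|α| ≤ (cC)^{-1}` (4.5) for all `1 ≤ c ≤ C` … `l_0 = 0`, `k_0(x) = 1` (4.6) and the absolute value
of `ψ_0(a)` does not depend on `a`, say `|ψ_0(a)| = p(c) ≤ Ac^{-1}` (4.7). Finally we assume that
`∫|ĝ(α)|dα ≤ B` (4.8), `∫|α||ĝ(α)|²dα ≤ B²` (4.9)."

**(4.10), (4.13)–(4.14)** (p0010:L57–p0011:L27). "`2Σ_{c≤C<d≤c+C,(c,d)=1}∫₀^{1/cd}cos(2πn(a/c − α))dα = 1` if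
`n = 0`, `0` if `n ≠ 0` (4.10) where `ad ≡ 1 (mod c)` and `C ≥ 2` is at our disposal (see Proposition
11.1 of [I])"; `I = (C, min{c + C, 1/(|α|c)}]` (4.13), of length `≤ c`; "incomplete Kloostermann sums
for which Weil's bound yields `Σ*_{d∈I, d≡δ(q)} e((dl − ah)/c) ≪ (h,c)^{1/2}c^{1/2}τ(c)log C` (4.14)."

**Theorem 4.1, (4.15)–(4.17), Corollary 4.2 (4.19)** (p0011:L27–101). `r_c(h) = Σ*_{d mod c} e(dh/c)`
(4.15); `σ(h) = Σ_{c≥1} r_c(h)p(c)²` (4.16); `B(h) = {σ(h) + O(τ(h)A²C^{-1})}∫g(x+h)ḡ(x)dx +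
O(τ(h)qA²B²C^{3/2}(log C)²)` (4.17); with `C = 2√(qX)` and `g₁, g₂` of (4.18) on `[X,2X]`:
`B(h) = Σ_{m−n=h}λ(m)λ̄(n)g₁(m)g₂(n) = σ(h)∫g₁(x+h)g₂(x)dx + O(τ(h)(qAB)²X^{3/4}(log 3X)²)` (4.19).

**(4.21)–(4.24)** (p0012:L25–66). For the forms of level `q`: `p(c) = 0` for cusp forms; for the
Eisenstein series `E_𝔞`, `𝔞 ∼ 1/v`: `p(c) = (L(1,χ)/c)·√v` if `(c,q) = v`, `·√w` if `(c,q) = w`, `0`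
otherwise (4.21); kernels `k_m(x) = J_{k−1}((4π/c)√(mx/r))`, `r = q/(c,q)` (4.22); `ĝ_m(α) ≪
k²q^{3/2}cCm^{-5/4}` for `|α| ≤ (cC)^{-1}`, `C = 2√(qX)` (4.23); `ĝ(α) ≪ X(1+|α|X)^{-2}` (4.24).

**§3 (3.14)–(3.15), (3.20)–(3.21)** (p0009:L30–p0010:L3). In Proposition 3.2 every coefficient of
the summation formula carries the pseudo-eigenvalue `η = χ_s(a)χ_r(−c)η_F(r,s)` (3.15); in
Proposition 3.3 the leading coefficient `{χ_v(a)χ_w(c/v)τ(χ_v) + χ_w(a)χ_v(c/w)τ(χ_w)}L(1,χ)/c`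
and the factor `σ` of (3.20) carry the same `χ_s(a)`, `s = (c,q)`.

**§2 (2.19)** (p0006:L50–60). "Any real character `ψ ∈ Ĉl(K)` is given uniquely by
`ψ(𝔭) = χ_v(N𝔭)` if `p ∤ v`, `χ_w(N𝔭)` if `p ∤ w`, where `χ_vχ_w = χ_q` … they are called the genus
characters."

## Lean rendering / design choices (audit notes)

* `BumpFourierDecay c₁` = (4.24) as an interface (it gives (4.8)–(4.9) with absolute constants for
  the class (4.18)); `𝓕` is Mathlib's Fourier transform, `𝓕 g α = ∫e(−αx)g(x)dx`.
* `KernelFourierBound q B k` = (4.5) with `C = 2√(qX)` (the form Corollary 4.2 uses), for a family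
  of kernels `k c m` indexed by the modulus `c` and the dual frequency `m ≥ 1`.
* `IsVoronoiDatum A λ k p u φ l` = (4.3)–(4.4), (4.6)–(4.7) in the PRODUCT FORM
  `ψ_m(a) = u_c(a)·φ_c(m)`, `|u_c(a)| = 1`, `φ_c(0) = p(c) ≥ 0`, which is what Propositions 3.2/3.3
  deliver (one pseudo-eigenvalue per `(a, c)`) and is all the proof of Theorem 4.1 uses of "`ψ_m(a)`
  periodic in `a`" (it needs `ψ_{m₁}(a)ψ̄_{m₂}(a)` independent of `a` before (4.14)). Test functions:
  class `C²`, compactly supported in `(0,∞)`, complex-valued (print: "smooth"; (4.18)/(4.23) control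
  two derivatives and Theorem 4.1 applies (4.3) to `g(x)e(−αx)`). The pair `(a, ā)` is quantified as
  `a·ā ≡ 1 (mod c)`; the dual series is a `HasSum`.
* `ciSigma p h` = (4.16) as a `tsum` over `c ≥ 1` of `Re r_c(h)·p(c)²` (`r_c(h)` = the tree's
  `ramanujanSum c h`, real).
* `CircleMethodBound c₀` = the conclusion of Theorem 4.1 in the range of Corollary 4.2, written
  with `C⁻¹X ↦ X/√(qX)` and `C^{3/2}(log C)² ↦ (qX)^{3/4}(1+log(qX))²` (absolute factors in `c₀`),
  the shifted sum over `n ∈ [1, ⌊2X⌋]` exactly as in `ShiftedConvolutionBound`.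
* `ciBesselKernel r c m x` = `J₀((4π/c)√(mx/r(c)))` (4.22) at weight `k = 1` (tree `besselJ 0`).
* `ZeroDetectorIdentity` = (4.10) verbatim for integer `C ≥ 1` (`a = (d : ZMod c)⁻¹`); `IncompleteKloostermanBound K₀`
  = (4.14) for intervals of length `≤ c`, without residue classes mod `q` (product-form datum),
  `log C ↦ 1 + log c`. (Appended for the statement-level split S3b = S3b1 + S3b2 + S3b3.)
* `BesselJZeroAmplitude C_W` = the amplitude/phase form of `J₀` behind (4.22)–(4.23) (`k = 1`,
  variable `u = 2πy`): `J₀(u) = Re(e^{iu}W(u))`, `|W^{(ν)}(u)| ≤ C_W u^{−1/2−ν}`, `ν ≤ 2`, all `u > 0`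
  (`W` of class `C²` on `(0,∞)`, `iteratedDerivWithin` on `Ioi 0`). (Appended for the split S3c =
  S3c1 + S3c2.)
* `genusSigmaCoeff q ℓ v w c` = `p(c)` of (4.21) for the genus pair `q = vw` (decidable `if` on
  `Nat.gcd c q`). (Appended for the split S3e = S3e1 genus classification + S3e2 arithmetic (4.27)–(4.34).)
* `IsGenusCharFor ψ D` = "`ψ` is the genus character attached to the divisor `D`" stated BY VALUES
  as in the tree's `genusCharProd_agree`: `ψ([𝔭]) = (N𝔭/D)` (Jacobi symbol) for primes of norm
  prime to `D`; `voronoiMainCoeff q ℓ ψ c` = `p(c)` of (4.21) for `θ(z;ψ)`: `√s·ℓ/c` if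
  `IsGenusCharFor ψ s`, `s = (c,q)`, else `0` (`ℓ = L(1,χ)`; classical `if`).

WHAT THIS IS NOT: no theorem of the source is asserted — neither Theorem 4.1 nor Propositions
3.2/3.3 nor Theorems 4.3/4.4. «The programme SEARCHES and TYPES; no claim about Landau–Siegel
zeros, Theorems 1–2 of arXiv:2211.02515 or a repaired Margin232 until a kernel theorem says so.»

## References

* [ConreyIwaniec2002] B. Conrey, H. Iwaniec, Acta Arith. 103 (2002) 259–312, arXiv:math/0111012:
  §2 (2.19); §3 Propositions 3.2–3.3, (3.14)–(3.15), (3.20)–(3.21); §4 (4.2)–(4.9), Theorem 4.1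
  (4.15)–(4.17), Corollary 4.2 (4.18)–(4.19), (4.21)–(4.24).
-/

noncomputable section

open scoped NumberField FourierTransform
open Complex MeasureTheory

namespace Literature.NumberTheory.LFunctions

namespace ConreyIwaniec2002

open NumberField Literature.NumberTheory.LFunctions.NumberField
open Literature.Analysis.FunctionSpaces (besselJ)
open Literature.NumberTheory.Sieve (ramanujanSum)

/-- **(4.24), as an interface**: for the test functions of (4.18)/(4.23) on `[X, 2X]`
(`IsBumpOn X g`, `X ≥ 1/2`) the Fourier transform satisfies `|ĝ(α)| ≤ c₁·X·(1 + |α|X)^{-2}`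
("by partial integration"), whence (4.8) `∫|ĝ(α)|dα ≪ 1` and (4.9) `∫|α||ĝ(α)|²dα ≪ 1`.
Here `ĝ = 𝓕 g`, `𝓕 g α = ∫ e(−αx)g(x)dx` (Mathlib). [cite: ConreyIwaniec2002, §4 (4.24), (4.8)–(4.9)] -/
def BumpFourierDecay (c₁ : ℝ) : Prop :=
  ∀ X : ℝ, 1 / 2 ≤ X → ∀ g : ℝ → ℂ, IsBumpOn X g → ∀ α : ℝ,
    ‖𝓕 g α‖ ≤ c₁ * X / (1 + |α| * X) ^ 2

/-- **(4.5) with `C = 2√(qX)`** (the form Corollary 4.2 consumes): for a family of kernels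
`k_{c,m}(x)` (`c ≥ 1` the modulus, `m ≥ 1` the dual frequency), every `X ≥ 1/2`, every test
function `g` of (4.18) on `[X, 2X]`, every `1 ≤ c ≤ C` and `|α| ≤ (cC)^{-1}`:
`|ĝ_m(α)| ≤ B·c·C·m^{-5/4}`, `ĝ_m(α) = ∫ g(x)k_{c,m}(x)e(−αx)dx` (4.22).
[cite: ConreyIwaniec2002, §4 (4.5), Corollary 4.2, (4.22)] -/
def KernelFourierBound (q : ℕ) (B : ℝ) (kf : ℕ → ℕ → ℝ → ℂ) : Prop :=
  ∀ X : ℝ, 1 / 2 ≤ X → ∀ g : ℝ → ℂ, IsBumpOn X g →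
    ∀ c : ℕ, 1 ≤ c → (c : ℝ) ≤ 2 * Real.sqrt (q * X) →
      ∀ α : ℝ, |α| ≤ 1 / (c * (2 * Real.sqrt (q * X))) → ∀ m : ℕ, 1 ≤ m →
        ‖𝓕 (fun x ↦ g x * kf c m x) α‖ ≤
          B * c * (2 * Real.sqrt (q * X)) * (m : ℝ) ^ (-(5 / 4 : ℝ))

/-- **The summation datum (4.3)–(4.4), (4.6)–(4.7) of Theorem 4.1, in product form.** For the
arithmetic function `λ`: for every `c ≥ 1` and `a ā ≡ 1 (mod c)`, and every `g` of class `C²`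
compactly supported in `(0, ∞)` ("smooth and compactly supported on `ℝ⁺`"; class `C²` is what
(4.18)/(4.23) and the proof of Theorem 4.1 — which applies (4.3) to `g(x)e(−αx)` — require),
`S(a/c) = Σ_n λ(n)e(an/c)g(n) = Σ_{m ≥ 0} ψ_m(a)e(ā l_m/c)∫₀^∞ g(x)k_m(x)dx` (4.3), with
`l_0 = 0`, `k_0 = 1` (4.6), and the coefficients in the PRODUCT FORM `ψ_m(a) = u_c(a)·φ_c(m)`,
`|u_c(a)| = 1`, `φ_c(0) = p(c) ≥ 0` (so `|ψ_0(a)| = p(c)` does not depend on `a`, (4.7)),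
`p(c) ≤ A/c` (4.7), `|φ_c(m)| ≤ Aτ(m)/c` for `m ≥ 1` (4.4); the frequencies `l_m = l_c(m) ∈ ℤ` and
the kernels `k_m = k_{c,m}` may depend on `c` but not on `a`. The product form is what
Propositions 3.2/3.3 deliver (every coefficient of (3.14) carries the pseudo-eigenvalue
`η = χ_s(a)χ_r(−c)η_F(r,s)` (3.15); in (3.21) the leading coefficient and `σ` of (3.20) both carry
`χ_s(a)`, `s = (c,q)`), and it makes `ψ_{m₁}(a)ψ̄_{m₂}(a)` independent of `a` — the use print makes
of "`ψ_m(a)` periodic in `a` of period `q`" before (4.14). The dual series is recorded as a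
`HasSum` (absolutely convergent in the applications by (4.5)).
[cite: ConreyIwaniec2002, §4 (4.2)–(4.4), (4.6)–(4.7); §3 (3.14)–(3.15), (3.20)–(3.21)] -/
def IsVoronoiDatum (A : ℝ) (lam : ℕ → ℂ) (kf : ℕ → ℕ → ℝ → ℂ) (p : ℕ → ℝ) (u : ℕ → ℤ → ℂ)
    (φ : ℕ → ℕ → ℂ) (l : ℕ → ℕ → ℤ) : Prop :=
  ∀ c : ℕ, 1 ≤ c →
    0 ≤ p c ∧ p c ≤ A / c ∧
    (∀ m : ℕ, 1 ≤ m → ‖φ c m‖ ≤ A * (Nat.divisors m).card / c) ∧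
    ∀ a abar : ℤ, a * abar ≡ 1 [ZMOD c] →
      ‖u c a‖ = 1 ∧
      ∀ g : ℝ → ℂ, ContDiff ℝ 2 g → (∃ X₁ X₂ : ℝ, 0 < X₁ ∧ ∀ x ∉ Set.Icc X₁ X₂, g x = 0) →
        HasSum
          (fun m : ℕ ↦ u c a * φ c (m + 1) * (𝐞 (((abar * l c (m + 1) : ℤ) : ℝ) / c) : ℂ) *
            ∫ x in Set.Ioi (0 : ℝ), g x * kf c (m + 1) x)
          ((∑' n : ℕ, lam n * (𝐞 ((a : ℝ) * n / c) : ℂ) * g n) -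
            u c a * p c * ∫ x in Set.Ioi (0 : ℝ), g x)

/-- **`σ(h) = Σ_{c ≥ 1} r_c(h) p(c)²`** (4.16), `r_c(h)` the Ramanujan sum (4.15) (real:
`ramanujanSum_im`). [cite: ConreyIwaniec2002, §4 (4.15)–(4.16)] -/
def ciSigma (p : ℕ → ℝ) (h : ℕ) : ℝ :=
  ∑' c : ℕ, (ramanujanSum (c + 1) h).re * p (c + 1) ^ 2

/-- **Theorem 4.1 in the range of Corollary 4.2, as an interface with constant `c₀`**: under the
summation datum (`IsVoronoiDatum A …`) and (4.5) with `C = 2√(qX)` (`KernelFourierBound q B …`),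
for `X ≥ 1/2`, `g₁, g₂` of (4.18) on `[X, 2X]` and `h ≥ 1`:
`|Σ_{m−n=h} λ(m)λ̄(n)g₁(m)g₂(n) − σ(h)∫g₁(x+h)g₂(x)dx| ≤ c₀τ(h)A²(C⁻¹X + q·B²·C^{3/2}(log C)²)`
((4.17): the error `τ(h)A²C⁻¹` of the leading term times `|∫g₁(·+h)g₂| ≤ X`, plus
`τ(h)qA²B²C^{3/2}(log C)²`; written with `C⁻¹X ↦ X/√(qX)`, `C^{3/2}(log C)² ↦ (qX)^{3/4}(1+log(qX))²`,
absolute factors inside `c₀`). The shifted sum is written over `n ∈ [1, ⌊2X⌋]` as in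
`ShiftedConvolutionBound`. [cite: ConreyIwaniec2002, Theorem 4.1 (4.17), Corollary 4.2 (4.19)] -/
def CircleMethodBound (c₀ : ℝ) : Prop :=
  ∀ (q : ℕ), 2 ≤ q → ∀ (A B : ℝ), 1 ≤ A → 1 ≤ B →
    ∀ (lam : ℕ → ℂ) (kf : ℕ → ℕ → ℝ → ℂ) (p : ℕ → ℝ) (u : ℕ → ℤ → ℂ) (φ : ℕ → ℕ → ℂ)
      (l : ℕ → ℕ → ℤ), IsVoronoiDatum A lam kf p u φ l → KernelFourierBound q B kf →
      ∀ X : ℝ, 1 / 2 ≤ X → ∀ g₁ g₂ : ℝ → ℂ, IsBumpOn X g₁ → IsBumpOn X g₂ → ∀ h : ℕ, 1 ≤ h →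
        ‖(∑ n ∈ Finset.Icc 1 ⌊2 * X⌋₊,
              lam (n + h) * starRingEnd ℂ (lam n) * g₁ ((n : ℝ) + h) * g₂ n) -
            (ciSigma p h : ℂ) * ∫ x : ℝ, g₁ (x + h) * g₂ x‖ ≤
          c₀ * (Nat.divisors h).card * A ^ 2 *
            (X / Real.sqrt (q * X) +
              q * B ^ 2 * ((q : ℝ) * X) ^ (3 / 4 : ℝ) * (1 + Real.log (q * X)) ^ 2)

/-- **The weight-one kernels of (4.3)**: `k_m(x) = J_{k−1}((4π/c)√(mx/r))` with `k = 1`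
((4.22) display), `r = r(c)` (`= q/(c,q)` in Propositions 3.2/3.3); `J₀` is the tree's `besselJ 0`.
[cite: ConreyIwaniec2002, §4 (4.22); §3 (3.14), (3.21)] -/
def ciBesselKernel (r : ℕ → ℕ) (c m : ℕ) (x : ℝ) : ℂ :=
  ((besselJ 0 (4 * Real.pi / c * Real.sqrt (m * x / r c)) : ℝ) : ℂ)

/-- **"`ψ` is the genus character attached to the divisor `D` of `q`"** ((2.19): `ψ(𝔭) = χ_v(N𝔭)`
if `p ∤ v`, with `χ_v` the Jacobi symbol `(·/v)`), stated by values as in the tree's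
`genusCharProd_agree`: `ψ([𝔭]) = (N𝔭 / D)` for every prime `𝔭` of norm prime to `D`. (A class
group character is determined by these values; `D = 1` gives `ψ = 1`; for non-real `ψ` it fails
for every `D`.) [cite: ConreyIwaniec2002, §2 (2.19)–(2.20)] -/
def IsGenusCharFor {K : Type*} [Field K] [NumberField K] (ψ : ClassGroup (𝓞 K) →* ℂˣ)
    (D : ℕ) : Prop :=
  ∀ v : IsDedekindDomain.HeightOneSpectrum (𝓞 K), (Ideal.absNorm v.asIdeal).Coprime D →
    classGroupCharPrimeValue ψ v = (jacobiSym (Ideal.absNorm v.asIdeal : ℕ) D : ℂ)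

/-- **`p(c)` of (4.21) for the form `θ(z;ψ)`**: `p(c) = √s·ℓ/c` if `ψ` is the genus character
attached to `s = (c, q)` (the Eisenstein case with `(c,q) ∈ {v, w}`, leading term of (3.21) and
`πh = √qL(1,χ)`), and `p(c) = 0` otherwise (cusp forms: Proposition 3.2 has no leading term;
genus characters with `(c,q) ∉ {v,w}`: Remark after (3.21)); `ℓ = L(1,χ)`. Written as the (classical)
indicator of `{c | IsGenusCharFor ψ (c,q)}` applied to `c ↦ √(c,q)·ℓ/c`.
[cite: ConreyIwaniec2002, §4 (4.21); §3 (3.21)] -/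
def voronoiMainCoeff {K : Type*} [Field K] [NumberField K] (q : ℕ) (ℓ : ℝ)
    (ψ : ClassGroup (𝓞 K) →* ℂˣ) (c : ℕ) : ℝ :=
  Set.indicator {c : ℕ | IsGenusCharFor ψ (Nat.gcd c q)}
    (fun c : ℕ ↦ Real.sqrt (Nat.gcd c q) * ℓ / c) c

/-! ### The two inputs of Theorem 4.1 (statement-level split of stub S3b of SKELETON S3, v3) -/

/-- **The zero detector (4.10)** ("see Proposition 11.1 of [I]": the Farey dissection of order `C`
in Kloosterman's form): for an integer `C ≥ 1` and `n ∈ ℤ`,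
`2 Σ_{c ≤ C < d ≤ c + C, (c,d) = 1} ∫₀^{1/(cd)} cos(2πn(a/c − α)) dα = 1` if `n = 0`, `= 0` if `n ≠ 0`,
"where `ad ≡ 1 (mod c)`" (`a = d⁻¹ mod c`; for `c = 1`, `a = 0`). The pairs `(c, d)` are the pairs
(Farey point `a/c` of order `C`, left neighbour `a'/c'`) via `d = c + c'`, and `1/(cd)` is the
length of the left mediant arc at `a/c`; print's real `C ≥ 2` enters only through `⌊C⌋`.
[cite: ConreyIwaniec2002, §4 (4.10)] -/
def ZeroDetectorIdentity : Prop :=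
  ∀ (C : ℕ), 1 ≤ C → ∀ n : ℤ,
    2 * ∑ c ∈ Finset.Icc 1 C, ∑ d ∈ (Finset.Ioc C (c + C)).filter (fun d ↦ Nat.Coprime c d),
        ∫ α in (0 : ℝ)..(1 / ((c : ℝ) * d)),
          Real.cos (2 * Real.pi * n * ((((d : ZMod c)⁻¹).val : ℝ) / c - α)) =
      if n = 0 then 1 else 0

/-- **Incomplete Kloosterman sums (4.14), with constant `K₀`**: for `c ≥ 1`, `l, h ∈ ℤ` and an
interval of integers `I = (y₁, y₂]` of length at most `c` (the intervals (4.13) have length `≤ c`),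
`|Σ_{d ∈ I, (d,c)=1} e((l·d + h·d̄)/c)| ≤ K₀·τ(c)·(h,c)^{1/2}·c^{1/2}·(1 + log c)`, `d d̄ ≡ 1 (mod c)`
— "incomplete Kloosterman sums for which Weil's bound yields (4.14)" (by completion; the residue
classes `d ≡ δ (mod q)` of print are not needed for a datum in product form, see `IsVoronoiDatum`;
print's `log C` is `1 + log c` here, `c ≤ C`). Weil's bound for the complete sums is the tree's
PROVED `weil_kloosterman_bound_holds`. [cite: ConreyIwaniec2002, §4 (4.13)–(4.14)] -/
def IncompleteKloostermanBound (K₀ : ℝ) : Prop :=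
  ∀ (c : ℕ), 1 ≤ c → ∀ (l h y₁ y₂ : ℤ), y₁ ≤ y₂ → y₂ - y₁ ≤ c →
    ‖∑ d ∈ (Finset.Ioc y₁ y₂).filter (fun d : ℤ ↦ Int.gcd d c = 1),
        (𝐞 (((l * d + h * (((d : ZMod c)⁻¹).val : ℤ) : ℤ) : ℝ) / c) : ℂ)‖ ≤
      K₀ * (Nat.divisors c).card * Real.sqrt (Int.gcd h c) * Real.sqrt c * (1 + Real.log c)

/-! ### The amplitude/phase form of `J₀` (statement-level split of stub S3c of SKELETON S3, v6) -/

/-- **The non-oscillatory amplitude of `J₀`, with constant `C_W`** ((4.22)–(4.23): "the Bessel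
function can be written as `J_{k−1}(2πy) = W(y)e(y) + W̄(y)e(−y)` where `W(y)` is a smooth
non-oscillatory function whose derivatives satisfy `y^νW^{(ν)}(y) ≪ k²y^{−1/2}` if `ν = 0,1,2`"),
at `k = 1` and in the variable `u = 2πy`: there is `W : (0,∞) → ℂ` of class `C²` with
`J₀(u) = Re(e^{iu}W(u))` and `|W^{(ν)}(u)| ≤ C_W·u^{−1/2−ν}` for `ν ≤ 2` and ALL `u > 0` (e.g.
`W(u) = e^{−iu}H₀^{(1)}(u)`, Hankel's integral `√(2/πu)e^{−iπ/4}π^{−1/2}∫₀^∞e^{−t}t^{−1/2}(1+it/2u)^{−1/2}dt`,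
or the Laplace-type form obtained from Poisson's integral by moving the contour to `t = 1 + iτ`;
near `u = 0` the bounds hold because `|H₀^{(1)}(u)| ≍ |log u| ≤ Cu^{−1/2}`). `J₀` is the tree's
`besselJ 0`. [cite: ConreyIwaniec2002, §4 (4.22)–(4.23)] -/
def BesselJZeroAmplitude (C_W : ℝ) : Prop :=
  ∃ W : ℝ → ℂ, ContDiffOn ℝ 2 W (Set.Ioi 0) ∧
    (∀ u : ℝ, 0 < u → (besselJ 0 u : ℝ) = (Complex.exp (Complex.I * u) * W u).re) ∧
      ∀ ν : ℕ, ν ≤ 2 → ∀ u : ℝ, 0 < u →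
        ‖iteratedDerivWithin ν W (Set.Ioi 0) u‖ ≤ C_W * u ^ (-(1 / 2 : ℝ) - ν)

/-! ### The main-term coefficients of a genus pair (statement-level split of stub S3e of SKELETON S3, v7) -/

/-- **`p(c)` of (4.21) for the genus pair `q = vw`**: `p(c) = √v·ℓ/c` if `(c,q) = v`, `√w·ℓ/c` if
`(c,q) = w`, `0` otherwise (`ℓ = L(1,χ)`), so that `σ(h) = Σ_c r_c(h)p(c)² =
{vΣ_{(c,q)=v}r_c(h)c⁻² + wΣ_{(c,q)=w}r_c(h)c⁻²}ℓ²` is (4.27). For the form `θ(z;ψ)` with `ψ` the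
genus character of `{v, w}` this is `voronoiMainCoeff q ℓ ψ` (genus theory, (2.19)); for non-real
`ψ` the latter vanishes identically. [cite: ConreyIwaniec2002, §4 (4.21), (4.27)] -/
def genusSigmaCoeff (q : ℕ) (ℓ : ℝ) (v w : ℕ) (c : ℕ) : ℝ :=
  if Nat.gcd c q = v then Real.sqrt v * ℓ / c
  else if Nat.gcd c q = w then Real.sqrt w * ℓ / c else 0

end ConreyIwaniec2002

end Literature.NumberTheory.LFunctions

end
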